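import Literature.MathematicalPhysics.QuantumFieldTheory.Balaban1983to89.B6HjGtOpNormV1
import Literature.MathematicalPhysics.QuantumFieldTheory.Balaban1983to89.B6Ineq2122TwoScaleV1
import Literature.MathematicalPhysics.QuantumFieldTheory.Balaban1983to89.B6Cov2110TwoScaleV1

/-!
# `Balaban1983to89.B6Prop25BoundedTwoScaleV1` — T. Bałaban, *Propagators and renormalization transformations for lattice gauge theories. II*,
# Commun. Math. Phys. **96** (1984) 223–250 [Balaban1984PropagatorsII], PROPOSITION 2.5 p. 246, ITS GLOBAL L²-NORM MEMBER (first entry of (1.114) of [4], un-localized), AT TWO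
# LEVELS, FOR THE CONCRETE TWO-SCALE V1 DATA: the propagator `G = Δ_a⁻¹` of (2.90) is a bounded operator on `ℓ²`, `⟨J, GJ⟩ ≤ C‖J‖²` and
# `‖GJ‖ ≤ C‖J‖` with `C = C(d, L, a₀)` — UNIFORMLY in the volume `(m, K)`, in the scale `j` and in `Λ′`

statement-level skeleton of published theorems with citation tags; proofs where landed; nothing here is a claim about the Yang–Mills mass gap

PDF held: `paper:balaban1984-cmp96-propagators-rt-ii` (journal page = PDF page + 222), p. 246 [PDF 24]; `paper:balaban1984-cmp95-propagators-rt-i`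
([4]; journal page = PDF page + 16), p. 36 [PDF 20]; text layers read this session (`p0024.txt`, `p0020.txt`).  PRINT (verbatim; v1.1 replaces
v1.0's mis-transcribed wording of the proposition).  [B6] p. 246: *"From these representations we obtain all the necessary properties of the operators
H_j, G̃_j. They follow from the Proposition 1.2 and from the formulas and the inequalities (1.99)–(1.101) for Q_jG_jQ_j*. … All the above
considerations imply the following Proposition 2.5. The operator G_□ defined by (2.90) on the torus T_□ (or on the whole lattice ξZ^d) has the
representation (2.129) and satisfies all the inequalities (1.110)–(1.114) of the Proposition 1.2 with a positive constant δ₂ instead of δ₀. This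
constant depends on d and L only."*  The representation used: (2.129)
*"⟨J,GJ⟩ = ⟨J,∂H′_jC^{(j)}_ΛH′_j*∂*J⟩ + ⟨(J − ∂ΔH′_jC^{(j)}_ΛH′_j*∂*J), (G̃_j + H_jC̃^{(j)}_ΛH_j*)(J − ∂ΔH′_jC^{(j)}_ΛH′_j*∂*J)⟩"*.  [4] Prop. 1.2
p. 36 [PDF 20], (1.114) (verbatim, v1.1 — v1.0 paraphrased it wrongly): *"Finally there exists a constant O(1) such that ‖ζGJ‖, ‖ζ∇GJ‖, ‖ζG∇*J‖,
‖ζ∇G∇*J‖, ‖ζ∇∇GJ‖ ≤ O(1)e^{−δ₀|y−y′|}‖J‖ (1.114) for supp ζ ⊂ Δ(y), supp J ⊂ Δ(y′)"*, and *"The localized inequalities (1.110)–(1.114) imply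
immediately the following global inequalities … and (1.89), with the same dependence of the constants O(1)"* — what THIS FILE proves is the GLOBAL
(un-localized, no decay factor) `ℓ²` shadow of the FIRST entry of (1.114): `‖GJ‖ ≤ C‖J‖`.

CITATION HEADER (lean-in-tree rule) — WHAT IS REPRODUCED.  Phase-2 file of the `lit-balaban` typed skeleton (HOME `run/shared/lean/pub/lit-balaban/`),
seat **p22 gen 13** (B6 fold owner r03, referee ref-4; lane = Sect. C (2.95)–(2.147) on the concrete two-scale data
`…B6SectCTwoScaleV1Lattice.tsV1`), file 4 of 4 = THE ASSEMBLY; SKELETON row **B6.Prop2.5** (cells only; decl of record untouched) — until now the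
row held (2.129) for `tsV1` (this seat, `…B6Eq2129TwoScaleV1.eq2129_V1`), the one-level identification `G_j = G^{[4]}` (r03,
`…B6GOneLevelV1Bridge.TV_GE`) and the kernel-level members; THIS FILE adds the TWO-LEVEL ℓ²-BOUNDEDNESS MEMBER.  §1 the abstract assembly for ANY
`…B6SectCOperators.TwoScaleData` satisfying the printed identities (`IsLattice`) and positivity (`Positive`): **`inner_G_le_of_bounds`** — six
numbers `X₁ ≥ ‖∂H′_j‖`, `X₃ ≥ ‖∂ΔH′_j‖`, `X_H ≥ ‖H_j‖`, `X_C ≥ C^{(j)}_Λ`, `X_G ≥ G̃_j`, `X_Ct ≥ C̃^{(j)}_Λ` (as forms) give, through (2.129)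
(`…B6Repr2129Positivity.eq2129_of_pos`), `⟨J, GJ⟩ ≤ [X_CX₁² + (X_G + X_H²X_Ct)(1 + X₃X_CX₁)²]·‖J‖²` (`inner_K1_eq`: `⟨J, K₁J⟩ = ⟨y, C^{(j)}_Λy⟩`,
`y = H′_j*∂*J`, `‖y‖ ≤ X₁‖J‖` by file 3's `norm_adjoint_le`; `‖K₂J‖ ≤ X₃X_CX₁‖J‖` by file 3's `norm_le_of_form_le` for the covariance `C^{(j)}_Λ`;
`⟨u, H_jC̃H_j*u⟩ ≤ X_CtX_H²‖u‖²`), and **`norm_G_le_of_bounds`** (`‖GJ‖ ≤ [...]·‖J‖`, `G = G* ≥ 0`).  §2 THE CONCRETE DATA at the paper's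
scaling `c = η⁻¹ = L^j` with weights `a ≥ a₀·n^{d+1}` on `𝔅` (= [4]'s `a ≥ a₀` in r03's dictionary, `n = L^j`): the six numbers are file 2's
`norm_dE_hP_sq_le`/`norm_dE_lapE_hP_sq_le` (`X₁² = (d+1)A₁²n^{d+1}`, `X₃² = (d+1)³A₃²n^{d+1}`), file 3's `norm_Hj_le` (`X_H² = (d+1)²A_H²n^{d+1}`) and
`inner_Gt_le` (`X_G = γ₀(d+1,1)⁻¹`), this seat's gen 10 `…B6Cov2110TwoScaleV1.inner_C_le_V1'` (`X_C = (n^{d+1}c₀(8/L²)²)⁻¹`) and gen 11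
`…B6Ineq2122TwoScaleV1.inner_Ct_le_V1` (`X_Ct = (n^{d+1}min(a₀,1)Γ)⁻¹`, `Γ = (481(d+1)⁶L^{2(d+1)+4})⁻¹`); every power of `n` CANCELS:
**`prop25_inner_G_le_V1`** / **`prop25_norm_G_le_V1`** with the explicit `j`-free constant `C(d, L, a₀) = (d+1)A₁²q⁻¹ + (γ₀⁻¹ +
(d+1)²A_H²(min(a₀,1)Γ)⁻¹)(1 + (d+1)²A₁A₃q⁻¹)²`, `q = c₀(d+1)(8/L²)²` (written out in the statements; ours, crude), and **`prop25_l2_bounded_uniform`**: `∀ d L a₀ ∃ C ∀ m K j Λ′ a (≥ a₀n^{d+1}) J, ⟨J,GJ⟩ ≤ C‖J‖² ∧ ‖GJ‖ ≤ C‖J‖` — the quantifier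
order IS the uniformity «This constant depends on d and L only» (and on the weight floor `a₀`, as [4]'s constants depend on `a`); v1.1 §4 `prop25_l2_bounded_printed`:
the same for the PRINTED weights `…B6SectCTwoScaleV1.wPrinted (a·n^{d+1})` of (2.90)/(2.94) (floor `a`, `wPrinted_ge_floor`); v1.1 §5 the CURL part of the
`∇GJ` entry: `norm_curl_G_sq_le` (abstract: `‖∂GJ‖² + ‖R∂*GJ‖² ≤ β‖J‖²` from `Δ_aG = I`), `prop25_curl_G_le_V1` (`‖∂(GJ)‖² ≤ C‖J‖²`).  IMPORTS BY NAME, restating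
nothing (see the `open` lines).  THEOREMS ONLY (no definition, no `def … : Prop`); standard axioms.  HONEST SCOPE: (i) the GLOBAL ℓ²-norm bound
`‖GJ‖ ≤ C‖J‖` ONLY — neither the localization `ζ`, the decay factor `e^{−δ₀|y−y′|}` and the four derivative entries of (1.114), nor (1.110)–(1.113), the
Hölder members of [4] Prop. 1.2 are touched (kernel level stays in b05's/r03's files; `U = 1` throughout the V1 calculus); (ii) the TORUS case of (2.90)
(«on the torus T_□»; the «whole lattice ξZ^d» variant is not treated), finite tori `⟨d + 1, L, m, K, _, _⟩` with `[NeZero L]`, scaling `c = L^j`; (iii) constants ours and crude, their dependence on `(d, L, a₀)` explicit, on `(m, K, j, Λ′)` NONE; NOT summit progress.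
Unit `lit-balaban-p22` (gen 13), 2026-08-22.
-/

noncomputable section

open scoped InnerProductSpace BigOperators
open Finset

namespace Literature.MathematicalPhysics.QuantumFieldTheory.Balaban1983to89.B6Prop25BoundedTwoScaleV1

open LatticeFieldCalculus B5SectBStatements B6SectAOperatorsV1 B6SectCOperators B6SectCOperators.TwoScaleData B6SectCTwoScaleV1
  B6SectCTwoScaleV1Lattice B6CovarianceOperator
open BalabanImbrieJaffe1984to88.BIJ85AxialPropagator411 (BondSpace)
open B5Hk163Decay (MG163 MG163_nonneg)
open B5Hk163Strip (kappaN kappaN_pos kappa163 kappa163_pos)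
open B4TorusKernel (periodConst)
open B4Sect5Proof (latticeConst latticeConst_nonneg)
open B5Kernel166Decay (periodConst_pos)
open B6Hprime2132Holder (MGHD CHolder2132_nonneg)
open B6Hprime2101 (c0_2109 c0_2109_pos)
open B5Prop11Lattice (gammaZero gammaZero_pos)
open B6SectCPositivity (deltaA_pos deltaA_comp_G G_symm C_symm Dp_pos)
open B6Repr2129Positivity (eq2129_of_pos)
open B6HprimeOpNormV1 (norm_dE_hP_sq_le norm_dE_lapE_hP_sq_le)
open B6HjGtOpNormV1 (norm_le_of_form_le norm_adjoint_le inner_covOp_nonneg norm_Hj_le inner_Gt_le)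
open B6Cov2110TwoScaleV1 (inner_C_le_V1')
open B6Ineq2122TwoScaleV1 (inner_Ct_le_V1)

/-! ## §1  The abstract assembly through (2.129) -/

section Abstract

variable {A B W T Bs V : Type*}
  [NormedAddCommGroup A] [InnerProductSpace ℝ A] [FiniteDimensional ℝ A]
  [NormedAddCommGroup B] [InnerProductSpace ℝ B] [FiniteDimensional ℝ B]
  [NormedAddCommGroup W] [InnerProductSpace ℝ W] [FiniteDimensional ℝ W]
  [NormedAddCommGroup T] [InnerProductSpace ℝ T] [FiniteDimensional ℝ T]
  [NormedAddCommGroup Bs] [InnerProductSpace ℝ Bs] [FiniteDimensional ℝ Bs]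
  [NormedAddCommGroup V] [InnerProductSpace ℝ V] [FiniteDimensional ℝ V]
  {D : TwoScaleData A B W T Bs V}

/-- **the first term of (2.129)**: `⟨J, ∂H′_jC^{(j)}_ΛH′_j*∂*J⟩ = ⟨y, C^{(j)}_Λy⟩` with `y = H′_j*∂*J` (`∂*` the adjoint of `∂`).
[cite: Balaban1984PropagatorsII, (2.129) p.246] -/
theorem inner_K1_eq (hL : D.IsLattice) (J : A) :
    ⟪J, D.K1 J⟫_ℝ = ⟪LinearMap.adjoint D.hP (D.dv J), D.C (LinearMap.adjoint D.hP (D.dv J))⟫_ℝ := by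
  show ⟪J, D.grad (D.hP (D.C (LinearMap.adjoint D.hP (D.dv J))))⟫_ℝ = _
  rw [inner_grad_right hL, ← LinearMap.adjoint_inner_right D.hP (D.C (LinearMap.adjoint D.hP (D.dv J))) (D.dv J)]
  exact real_inner_comm _ _

/-- `∂* = (∂)*` as linear maps (the printed identity `grad_adj` of `IsLattice`). [cite: Balaban1984PropagatorsII, (2.19) p.226] -/
theorem dv_eq_adjoint_grad (hL : D.IsLattice) : D.dv = LinearMap.adjoint D.grad := by
  rw [LinearMap.eq_adjoint_iff]
  intro x b
  rw [real_inner_comm b (D.dv x), ← hL.grad_adj b x]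
  exact real_inner_comm _ _

/-- `⟨J, GJ⟩ ≥ 0` (`G = Δ_a⁻¹`, `Δ_a > 0`). [cite: Balaban1984PropagatorsII, (2.22) p.226] -/
theorem inner_G_nonneg (hL : D.IsLattice) (hP : D.Positive) (J : A) : 0 ≤ ⟪J, D.G J⟫_ℝ := by
  rcases eq_or_ne J 0 with rfl | hJ
  · rw [inner_zero_left]
  · exact (inverse_pos D.deltaA (deltaA_pos hL hP) J hJ).le

/-- **THE ABSTRACT ASSEMBLY OF THE L²-BOUND THROUGH (2.129)**: for two-scale data satisfying the printed identities and positivity, operator /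
form bounds `‖∂H′_jμ‖ ≤ X₁‖μ‖`, `‖∂ΔH′_jμ‖ ≤ X₃‖μ‖`, `‖H_jb‖ ≤ X_H‖b‖`, `⟨v, C^{(j)}_Λv⟩ ≤ X_C‖v‖²`, `⟨x, G̃_jx⟩ ≤ X_G‖x‖²`, `⟨b, C̃^{(j)}_Λb⟩ ≤ X_Ct‖b‖²`
give **`⟨J, GJ⟩ ≤ [X_CX₁² + (X_G + X_H²X_Ct)(1 + X₃X_CX₁)²]·‖J‖²`**. [cite: Balaban1984PropagatorsII, Prop. 2.5 p.246 (via (2.129); assembly ours)] -/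
theorem inner_G_le_of_bounds (hL : D.IsLattice) (hP : D.Positive) {X₁ X₃ XH XC XG XCt : ℝ}
    (h0₁ : 0 ≤ X₁) (h0₃ : 0 ≤ X₃) (h0H : 0 ≤ XH) (h0C : 0 ≤ XC) (h0G : 0 ≤ XG) (h0Ct : 0 ≤ XCt)
    (h₁ : ∀ μ, ‖D.grad (D.hP μ)‖ ≤ X₁ * ‖μ‖) (h₃ : ∀ μ, ‖D.grad (D.lap (D.hP μ))‖ ≤ X₃ * ‖μ‖)
    (hH : ∀ b, ‖D.Hj b‖ ≤ XH * ‖b‖) (hC : ∀ v, ⟪v, D.C v⟫_ℝ ≤ XC * ‖v‖ ^ 2)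
    (hG : ∀ x, ⟪x, D.Gt x⟫_ℝ ≤ XG * ‖x‖ ^ 2) (hCt : ∀ b, ⟪b, D.Ct b⟫_ℝ ≤ XCt * ‖b‖ ^ 2) (J : A) :
    ⟪J, D.G J⟫_ℝ ≤ (XC * X₁ ^ 2 + (XG + XH ^ 2 * XCt) * (1 + X₃ * XC * X₁) ^ 2) * ‖J‖ ^ 2 := by
  set y := LinearMap.adjoint D.hP (D.dv J) with hy
  -- `‖y‖ = ‖(∂H′_j)*J‖ ≤ X₁‖J‖`
  have hy1 : ‖y‖ ≤ X₁ * ‖J‖ := by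
    have e : y = LinearMap.adjoint (D.grad ∘ₗ D.hP) J := by
      rw [LinearMap.adjoint_comp, LinearMap.comp_apply, ← dv_eq_adjoint_grad hL]
    rw [e]
    exact norm_adjoint_le _ h0₁ (fun μ => h₁ μ) J
  -- `C^{(j)}_Λ`: non-negative, symmetric, `‖Cy‖ ≤ X_C‖y‖`
  have hC0 : ∀ v, 0 ≤ ⟪v, D.C v⟫_ℝ := inner_covOp_nonneg D.S₁ D.Dp (fun k hk => Dp_pos hL hP k hk)
  have hCn : ‖D.C y‖ ≤ XC * ‖y‖ := norm_le_of_form_le D.C (C_symm hL hP) hC0 h0C hC y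
  -- the first term
  have hK1 : ⟪J, D.K1 J⟫_ℝ ≤ XC * X₁ ^ 2 * ‖J‖ ^ 2 := by
    rw [inner_K1_eq hL]
    calc ⟪y, D.C y⟫_ℝ ≤ XC * ‖y‖ ^ 2 := hC y
      _ ≤ XC * (X₁ * ‖J‖) ^ 2 := mul_le_mul_of_nonneg_left (pow_le_pow_left₀ (norm_nonneg _) hy1 2) h0C
      _ = XC * X₁ ^ 2 * ‖J‖ ^ 2 := by ring
  -- `‖K₂J‖ ≤ X₃X_CX₁‖J‖`, `u = J − K₂J`
  have hK2 : ‖D.K2 J‖ ≤ X₃ * XC * X₁ * ‖J‖ := by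
    have e : D.K2 J = D.grad (D.lap (D.hP (D.C y))) := rfl
    rw [e]
    calc ‖D.grad (D.lap (D.hP (D.C y)))‖ ≤ X₃ * ‖D.C y‖ := h₃ _
      _ ≤ X₃ * (XC * (X₁ * ‖J‖)) := mul_le_mul_of_nonneg_left (hCn.trans (mul_le_mul_of_nonneg_left hy1 h0C)) h0₃
      _ = X₃ * XC * X₁ * ‖J‖ := by ring
  set u := J - D.K2 J with hu
  have hu1 : ‖u‖ ≤ (1 + X₃ * XC * X₁) * ‖J‖ := by
    calc ‖u‖ ≤ ‖J‖ + ‖D.K2 J‖ := norm_sub_le _ _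
      _ ≤ ‖J‖ + X₃ * XC * X₁ * ‖J‖ := by linarith [hK2]
      _ = (1 + X₃ * XC * X₁) * ‖J‖ := by ring
  -- the second term
  have hHu : ‖LinearMap.adjoint D.Hj u‖ ≤ XH * ‖u‖ := norm_adjoint_le _ h0H hH u
  have h2 : ⟪u, (D.Gt + D.Hj ∘ₗ D.Ct ∘ₗ LinearMap.adjoint D.Hj) u⟫_ℝ ≤ (XG + XH ^ 2 * XCt) * ‖u‖ ^ 2 := by
    rw [LinearMap.add_apply, inner_add_right, LinearMap.comp_apply, LinearMap.comp_apply,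
      ← LinearMap.adjoint_inner_left D.Hj (D.Ct (LinearMap.adjoint D.Hj u)) u]
    have a1 := hG u
    have a2 : ⟪LinearMap.adjoint D.Hj u, D.Ct (LinearMap.adjoint D.Hj u)⟫_ℝ ≤ XCt * (XH * ‖u‖) ^ 2 :=
      (hCt _).trans (mul_le_mul_of_nonneg_left (pow_le_pow_left₀ (norm_nonneg _) hHu 2) h0Ct)
    have a3 : XCt * (XH * ‖u‖) ^ 2 = XH ^ 2 * XCt * ‖u‖ ^ 2 := by ring
    linarith
  have h2' : ⟪u, (D.Gt + D.Hj ∘ₗ D.Ct ∘ₗ LinearMap.adjoint D.Hj) u⟫_ℝ ≤ (XG + XH ^ 2 * XCt) * ((1 + X₃ * XC * X₁) * ‖J‖) ^ 2 :=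
    h2.trans (mul_le_mul_of_nonneg_left (pow_le_pow_left₀ (norm_nonneg _) hu1 2) (by positivity))
  rw [eq2129_of_pos hL hP J, ← hu]
  calc ⟪J, D.K1 J⟫_ℝ + ⟪u, (D.Gt + D.Hj ∘ₗ D.Ct ∘ₗ LinearMap.adjoint D.Hj) u⟫_ℝ
      ≤ XC * X₁ ^ 2 * ‖J‖ ^ 2 + (XG + XH ^ 2 * XCt) * ((1 + X₃ * XC * X₁) * ‖J‖) ^ 2 := add_le_add hK1 h2'
    _ = (XC * X₁ ^ 2 + (XG + XH ^ 2 * XCt) * (1 + X₃ * XC * X₁) ^ 2) * ‖J‖ ^ 2 := by ring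

/-- **… and the operator form `‖GJ‖ ≤ [X_CX₁² + (X_G + X_H²X_Ct)(1 + X₃X_CX₁)²]·‖J‖`** (`G` symmetric and non-negative; file 3's
`norm_le_of_form_le`). [cite: Balaban1984PropagatorsII, Prop. 2.5 p.246 (global form of the first (1.114) entry; assembly ours)] -/
theorem norm_G_le_of_bounds (hL : D.IsLattice) (hP : D.Positive) {X₁ X₃ XH XC XG XCt : ℝ}
    (h0₁ : 0 ≤ X₁) (h0₃ : 0 ≤ X₃) (h0H : 0 ≤ XH) (h0C : 0 ≤ XC) (h0G : 0 ≤ XG) (h0Ct : 0 ≤ XCt)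
    (h₁ : ∀ μ, ‖D.grad (D.hP μ)‖ ≤ X₁ * ‖μ‖) (h₃ : ∀ μ, ‖D.grad (D.lap (D.hP μ))‖ ≤ X₃ * ‖μ‖)
    (hH : ∀ b, ‖D.Hj b‖ ≤ XH * ‖b‖) (hC : ∀ v, ⟪v, D.C v⟫_ℝ ≤ XC * ‖v‖ ^ 2)
    (hG : ∀ x, ⟪x, D.Gt x⟫_ℝ ≤ XG * ‖x‖ ^ 2) (hCt : ∀ b, ⟪b, D.Ct b⟫_ℝ ≤ XCt * ‖b‖ ^ 2) (J : A) :
    ‖D.G J‖ ≤ (XC * X₁ ^ 2 + (XG + XH ^ 2 * XCt) * (1 + X₃ * XC * X₁) ^ 2) * ‖J‖ :=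
  norm_le_of_form_le D.G (G_symm hL hP) (inner_G_nonneg hL hP) (by positivity)
    (inner_G_le_of_bounds hL hP h0₁ h0₃ h0H h0C h0G h0Ct h₁ h₃ hH hC hG hCt) J

end Abstract

/-! ## §2  The concrete two-scale data at the paper's scaling `c = η⁻¹ = L^j`, weights `a ≥ a₀·n^{d+1}` -/

section Concrete

variable {d L m K : ℕ} [NeZero L] {hd : 1 ≤ d + 1} {hL : Odd L ∧ 1 < L} {j : ℕ} (hc : ((L : ℝ) ^ j) ≠ 0)
  (hj : j + 1 ≤ (⟨d + 1, L, m, K, hd, hL⟩ : Params).m + (⟨d + 1, L, m, K, hd, hL⟩ : Params).K)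
  (Λ' : Finset (Site (⟨d + 1, L, m, K, hd, hL⟩ : Params) (j + 1))) {w : CIdx j Λ' → ℝ} {a₀ : ℝ} (ha₀ : 0 < a₀)
  (hw0 : ∀ i, a₀ * ((L : ℝ) ^ j) ^ (d + 1) ≤ w i)

include hj ha₀ hw0

/-- **PROPOSITION 2.5, THE GLOBAL L²-NORM MEMBER (first entry of (1.114) of [4], un-localized), AT TWO LEVELS, FOR THE CONCRETE TWO-SCALE V1 DATA,
AS A FORM**: at the scaling
`c = η⁻¹ = L^j` and for weights `a ≥ a₀·n^{d+1}` on `𝔅 = Λ^c ∪ Λ′` (`n = L^j`; [4]'s `a ≥ a₀`), **`⟨J, GJ⟩ ≤ C(d, L, a₀)·‖J‖²`** for every `J`, with the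
explicit constant displayed — NO dependence on the volume `(m, K)`, on `j`, or on `Λ′` (*"This constant depends on d and L only"*).
[cite: Balaban1984PropagatorsII, Prop. 2.5 p.246] -/
theorem prop25_inner_G_le_V1 (J : BondSpace (⟨d + 1, L, m, K, hd, hL⟩ : Params)) :
    ⟪J, (tsV1 hc Λ' w).G J⟫_ℝ ≤
      ((d + 1 : ℝ) * (MGHD (d + 1) 1 * periodConst (kappaN (d + 1)) d * latticeConst (d + 1) (kappaN (d + 1) / (d + 1))) ^ 2 *
          (c0_2109 (d + 1) * (8 / (L : ℝ) ^ 2) ^ 2)⁻¹ +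
        ((gammaZero (d + 1) 1)⁻¹ +
            ((d + 1 : ℝ) * (MG163 (d + 1) * periodConst (kappa163 (d + 1)) d * latticeConst (d + 1) (kappa163 (d + 1) / (d + 1)))) ^ 2 *
              (min a₀ 1 * (481 * (d + 1 : ℝ) ^ 6 * (L : ℝ) ^ (2 * (d + 1) + 4))⁻¹)⁻¹) *
          (1 + (d + 1 : ℝ) ^ 2 *
              (MGHD (d + 1) 1 * periodConst (kappaN (d + 1)) d * latticeConst (d + 1) (kappaN (d + 1) / (d + 1))) *
              (MGHD (d + 1) 3 * periodConst (kappaN (d + 1)) d * latticeConst (d + 1) (kappaN (d + 1) / (d + 1))) *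
              (c0_2109 (d + 1) * (8 / (L : ℝ) ^ 2) ^ 2)⁻¹) ^ 2) * ‖J‖ ^ 2 := by
  have hj' : j ≤ (⟨d + 1, L, m, K, hd, hL⟩ : Params).m + (⟨d + 1, L, m, K, hd, hL⟩ : Params).K := Nat.le_of_succ_le hj
  have hLpos : (0 : ℝ) < L := Nat.cast_pos.2 (Nat.pos_of_ne_zero (NeZero.ne L))
  set N : ℝ := ((L : ℝ) ^ j) ^ (d + 1) with hN
  have hN0 : 0 < N := by positivity
  have hw : ∀ i, 0 < w i := fun i => lt_of_lt_of_le (by positivity) (hw0 i)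
  have hLat := isLattice Λ' hc hj hw
  have hPos := positive Λ' hc hj w
  set A₁ : ℝ := MGHD (d + 1) 1 * periodConst (kappaN (d + 1)) d * latticeConst (d + 1) (kappaN (d + 1) / (d + 1)) with hA₁
  set A₃ : ℝ := MGHD (d + 1) 3 * periodConst (kappaN (d + 1)) d * latticeConst (d + 1) (kappaN (d + 1) / (d + 1)) with hA₃
  set AH : ℝ := MG163 (d + 1) * periodConst (kappa163 (d + 1)) d * latticeConst (d + 1) (kappa163 (d + 1) / (d + 1)) with hAH
  set q : ℝ := c0_2109 (d + 1) * (8 / (L : ℝ) ^ 2) ^ 2 with hq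
  set Γ : ℝ := (481 * (d + 1 : ℝ) ^ 6 * (L : ℝ) ^ (2 * (d + 1) + 4))⁻¹ with hΓ
  have hκN : 0 < kappaN (d + 1) / (d + 1) := div_pos (kappaN_pos _) (by positivity)
  have hκ163 : 0 < kappa163 (d + 1) / (d + 1) := div_pos (kappa163_pos _) (by positivity)
  have hA₁0 : 0 ≤ A₁ := mul_nonneg (mul_nonneg (by unfold MGHD; exact mul_nonneg (pow_nonneg (Real.exp_pos 1).le _) (CHolder2132_nonneg _ _ _))
    (periodConst_pos (kappaN_pos _) _).le) (latticeConst_nonneg _ hκN.le)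
  have hA₃0 : 0 ≤ A₃ := mul_nonneg (mul_nonneg (by unfold MGHD; exact mul_nonneg (pow_nonneg (Real.exp_pos 1).le _) (CHolder2132_nonneg _ _ _))
    (periodConst_pos (kappaN_pos _) _).le) (latticeConst_nonneg _ hκN.le)
  have hAH0 : 0 ≤ AH := mul_nonneg (mul_nonneg (MG163_nonneg _) (periodConst_pos (kappa163_pos _) _).le) (latticeConst_nonneg _ hκ163.le)
  have hq0 : 0 < q := mul_pos (c0_2109_pos _) (by positivity)
  have hΓ0 : 0 < Γ := by positivity
  have hγ0 : 0 < gammaZero (d + 1) 1 := gammaZero_pos _ _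
  have hm0 : 0 < min a₀ 1 := lt_min ha₀ one_pos
  set s₁ : ℝ := Real.sqrt (d + 1 : ℝ) with hs₁
  set s₂ : ℝ := Real.sqrt N with hs₂
  have hs1 : s₁ ^ 2 = (d + 1 : ℝ) := Real.sq_sqrt (by positivity)
  have hs2 : s₂ ^ 2 = N := Real.sq_sqrt hN0.le
  have hs₁0 : 0 ≤ s₁ := Real.sqrt_nonneg _
  have hs₂0 : 0 ≤ s₂ := Real.sqrt_nonneg _
  -- the six bounds
  have h₁ : ∀ μ, ‖(tsV1 hc Λ' w).grad ((tsV1 hc Λ' w).hP μ)‖ ≤ s₁ * A₁ * s₂ * ‖μ‖ := by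
    intro μ
    have h := norm_dE_hP_sq_le hc hj' μ
    rw [div_self hc, one_pow, one_mul] at h
    refine le_of_sq_le_sq ?_ (by positivity)
    calc ‖(tsV1 hc Λ' w).grad ((tsV1 hc Λ' w).hP μ)‖ ^ 2 ≤ (d + 1 : ℝ) * (A₁ ^ 2 * N * ‖μ‖ ^ 2) := h
      _ = (s₁ * A₁ * s₂ * ‖μ‖) ^ 2 := by
          have e : (s₁ * A₁ * s₂ * ‖μ‖) ^ 2 = s₁ ^ 2 * A₁ ^ 2 * s₂ ^ 2 * ‖μ‖ ^ 2 := by ring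
          rw [e, hs1, hs2]; ring
  have h₃ : ∀ μ, ‖(tsV1 hc Λ' w).grad ((tsV1 hc Λ' w).lap ((tsV1 hc Λ' w).hP μ))‖ ≤ (d + 1 : ℝ) * s₁ * A₃ * s₂ * ‖μ‖ := by
    intro μ
    have h := norm_dE_lapE_hP_sq_le hc hj' μ
    rw [div_self hc, one_pow, one_mul] at h
    refine le_of_sq_le_sq ?_ (by positivity)
    calc ‖(tsV1 hc Λ' w).grad ((tsV1 hc Λ' w).lap ((tsV1 hc Λ' w).hP μ))‖ ^ 2 ≤ (d + 1 : ℝ) ^ 3 * (A₃ ^ 2 * N * ‖μ‖ ^ 2) := h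
      _ = ((d + 1 : ℝ) * s₁ * A₃ * s₂ * ‖μ‖) ^ 2 := by
          have e : ((d + 1 : ℝ) * s₁ * A₃ * s₂ * ‖μ‖) ^ 2 = (d + 1 : ℝ) ^ 2 * s₁ ^ 2 * A₃ ^ 2 * s₂ ^ 2 * ‖μ‖ ^ 2 := by ring
          rw [e, hs1, hs2]; ring
  have hH : ∀ b, ‖(tsV1 hc Λ' w).Hj b‖ ≤ (d + 1 : ℝ) * AH * s₂ * ‖b‖ := fun b => norm_Hj_le hc hj Λ' hw b
  have hC : ∀ v, ⟪v, (tsV1 hc Λ' w).C v⟫_ℝ ≤ (N * q)⁻¹ * ‖v‖ ^ 2 := by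
    intro v
    have h := inner_C_le_V1' hc hj Λ' hw v
    dsimp only at h
    rw [div_self hc, one_pow, one_mul] at h
    exact h
  have hG : ∀ x, ⟪x, (tsV1 hc Λ' w).Gt x⟫_ℝ ≤ (gammaZero (d + 1) 1)⁻¹ * ‖x‖ ^ 2 := fun x => inner_Gt_le hc hj Λ' hw x
  have hCt : ∀ b, ⟪b, (tsV1 hc Λ' w).Ct b⟫_ℝ ≤ (min a₀ 1 * N * Γ)⁻¹ * ‖b‖ ^ 2 := by
    intro b
    have h := inner_Ct_le_V1 hc hj Λ' hw (w₀ := a₀ * N) (by positivity) hw0 b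
    have hκ : ((L : ℝ) ^ j) ^ 2 / (eta L j ^ (d + 1) * ((L : ℝ) ^ j) ^ 2) = N := by
      have hx : (((L : ℝ) ^ j) ^ 2) ≠ 0 := pow_ne_zero _ hc
      have hx' : (((L : ℝ) ^ j) ^ (d + 1)) ≠ 0 := pow_ne_zero _ hc
      rw [eta, hN, inv_pow, div_eq_iff (mul_ne_zero (inv_ne_zero hx') hx), ← mul_assoc, mul_inv_cancel₀ hx', one_mul]
    have hmin : min (a₀ * N) (((L : ℝ) ^ j) ^ 2 / (eta L j ^ (d + 1) * ((L : ℝ) ^ j) ^ 2)) = min a₀ 1 * N := by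
      rw [hκ, min_mul_of_nonneg _ _ hN0.le, one_mul]
    have hP2 : ‖(tsV1 hc Λ' w).Ax.starProjection b‖ ^ 2 ≤ ‖b‖ ^ 2 :=
      pow_le_pow_left₀ (norm_nonneg _) (Submodule.norm_starProjection_apply_le _ b) 2
    dsimp only at h
    rw [hmin] at h
    push_cast at h
    refine h.trans ?_
    have e : (min a₀ 1 * N * (481 * ((d : ℝ) + 1) ^ 6 * (L : ℝ) ^ (2 * (d + 1) + 4))⁻¹)⁻¹ = (min a₀ 1 * N * Γ)⁻¹ := by rw [hΓ]
    rw [e]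
    exact mul_le_mul_of_nonneg_left hP2 (by positivity)
  have hmain := inner_G_le_of_bounds hLat hPos (X₁ := s₁ * A₁ * s₂) (X₃ := (d + 1 : ℝ) * s₁ * A₃ * s₂) (XH := (d + 1 : ℝ) * AH * s₂)
    (XC := (N * q)⁻¹) (XG := (gammaZero (d + 1) 1)⁻¹) (XCt := (min a₀ 1 * N * Γ)⁻¹)
    (by positivity) (by positivity) (by positivity) (by positivity) (by positivity) (by positivity) h₁ h₃ hH hC hG hCt J
  refine hmain.trans (le_of_eq ?_)
  congr 1
  have e : (N * q)⁻¹ * (s₁ * A₁ * s₂) ^ 2 +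
      ((gammaZero (d + 1) 1)⁻¹ + ((d + 1 : ℝ) * AH * s₂) ^ 2 * (min a₀ 1 * N * Γ)⁻¹) *
        (1 + (d + 1 : ℝ) * s₁ * A₃ * s₂ * (N * q)⁻¹ * (s₁ * A₁ * s₂)) ^ 2 =
      (N * q)⁻¹ * (s₁ ^ 2 * A₁ ^ 2 * s₂ ^ 2) +
      ((gammaZero (d + 1) 1)⁻¹ + (d + 1 : ℝ) ^ 2 * AH ^ 2 * s₂ ^ 2 * (min a₀ 1 * N * Γ)⁻¹) *
        (1 + (d + 1 : ℝ) * s₁ ^ 2 * s₂ ^ 2 * A₃ * A₁ * (N * q)⁻¹) ^ 2 := by ring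
  rw [e, hs1, hs2]
  field_simp

/-- **PROPOSITION 2.5, THE GLOBAL L²-NORM MEMBER, AT TWO LEVELS, FOR THE CONCRETE DATA, AS AN OPERATOR BOUND**: `‖GJ‖ ≤ C(d, L, a₀)·‖J‖` (same constant;
`G` symmetric and non-negative). [cite: Balaban1984PropagatorsII, Prop. 2.5 p.246] -/
theorem prop25_norm_G_le_V1 (J : BondSpace (⟨d + 1, L, m, K, hd, hL⟩ : Params)) :
    ‖(tsV1 hc Λ' w).G J‖ ≤
      ((d + 1 : ℝ) * (MGHD (d + 1) 1 * periodConst (kappaN (d + 1)) d * latticeConst (d + 1) (kappaN (d + 1) / (d + 1))) ^ 2 *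
          (c0_2109 (d + 1) * (8 / (L : ℝ) ^ 2) ^ 2)⁻¹ +
        ((gammaZero (d + 1) 1)⁻¹ +
            ((d + 1 : ℝ) * (MG163 (d + 1) * periodConst (kappa163 (d + 1)) d * latticeConst (d + 1) (kappa163 (d + 1) / (d + 1)))) ^ 2 *
              (min a₀ 1 * (481 * (d + 1 : ℝ) ^ 6 * (L : ℝ) ^ (2 * (d + 1) + 4))⁻¹)⁻¹) *
          (1 + (d + 1 : ℝ) ^ 2 *
              (MGHD (d + 1) 1 * periodConst (kappaN (d + 1)) d * latticeConst (d + 1) (kappaN (d + 1) / (d + 1))) *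
              (MGHD (d + 1) 3 * periodConst (kappaN (d + 1)) d * latticeConst (d + 1) (kappaN (d + 1) / (d + 1))) *
              (c0_2109 (d + 1) * (8 / (L : ℝ) ^ 2) ^ 2)⁻¹) ^ 2) * ‖J‖ := by
  have hw : ∀ i, 0 < w i := fun i => lt_of_lt_of_le (by positivity) (hw0 i)
  have hLpos : (0 : ℝ) < L := Nat.cast_pos.2 (Nat.pos_of_ne_zero (NeZero.ne L))
  have hκN : 0 < kappaN (d + 1) / (d + 1) := div_pos (kappaN_pos _) (by positivity)
  have hκ163 : 0 < kappa163 (d + 1) / (d + 1) := div_pos (kappa163_pos _) (by positivity)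
  have hA₁0 : 0 ≤ MGHD (d + 1) 1 * periodConst (kappaN (d + 1)) d * latticeConst (d + 1) (kappaN (d + 1) / (d + 1)) :=
    mul_nonneg (mul_nonneg (by unfold MGHD; exact mul_nonneg (pow_nonneg (Real.exp_pos 1).le _) (CHolder2132_nonneg _ _ _))
      (periodConst_pos (kappaN_pos _) _).le) (latticeConst_nonneg _ hκN.le)
  have hA₃0 : 0 ≤ MGHD (d + 1) 3 * periodConst (kappaN (d + 1)) d * latticeConst (d + 1) (kappaN (d + 1) / (d + 1)) :=
    mul_nonneg (mul_nonneg (by unfold MGHD; exact mul_nonneg (pow_nonneg (Real.exp_pos 1).le _) (CHolder2132_nonneg _ _ _))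
      (periodConst_pos (kappaN_pos _) _).le) (latticeConst_nonneg _ hκN.le)
  have hq0 : 0 < c0_2109 (d + 1) * (8 / (L : ℝ) ^ 2) ^ 2 := mul_pos (c0_2109_pos _) (by positivity)
  have hγ0 : 0 < gammaZero (d + 1) 1 := gammaZero_pos _ _
  have hm0 : 0 < min a₀ 1 := lt_min ha₀ one_pos
  exact norm_le_of_form_le (tsV1 hc Λ' w).G (G_symm (isLattice Λ' hc hj hw) (positive Λ' hc hj w))
    (inner_G_nonneg (isLattice Λ' hc hj hw) (positive Λ' hc hj w)) (by positivity)
    (prop25_inner_G_le_V1 hc hj Λ' ha₀ hw0) J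

end Concrete

/-! ## §3  The uniformity in the printed quantifier order -/

/-- **PROPOSITION 2.5 (GLOBAL L²-NORM MEMBER, TWO LEVELS) — «THIS CONSTANT DEPENDS ON d AND L ONLY»**: for every dimension `d + 1`, every odd `L > 1` and
every weight floor `a₀ > 0` there is ONE constant `C` such that FOR ALL volumes `(m, K)`, scales `j` (`j + 1 ≤ m + K`), regions `Λ′ ⊂ T^{(j+1)}`, weights
`a ≥ a₀·n^{d+1}` and all `J`: `⟨J, GJ⟩ ≤ C‖J‖²` and `‖GJ‖ ≤ C‖J‖`, `G = Δ_a⁻¹` the propagator (2.90) of the two-scale V1 data at `c = L^j`.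
[cite: Balaban1984PropagatorsII, Prop. 2.5 p.246] -/
theorem prop25_l2_bounded_uniform (d L : ℕ) [NeZero L] (hd : 1 ≤ d + 1) (hL : Odd L ∧ 1 < L) {a₀ : ℝ} (ha₀ : 0 < a₀) :
    ∃ C : ℝ, ∀ (m K j : ℕ) (hj : j + 1 ≤ m + K) (Λ' : Finset (Site (⟨d + 1, L, m, K, hd, hL⟩ : Params) (j + 1)))
      (w : CIdx j Λ' → ℝ), (∀ i, a₀ * ((L : ℝ) ^ j) ^ (d + 1) ≤ w i) →
        ∀ J : BondSpace (⟨d + 1, L, m, K, hd, hL⟩ : Params),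
          ⟪J, (tsV1 (pow_ne_zero j (Nat.cast_ne_zero.2 (NeZero.ne L))) Λ' w).G J⟫_ℝ ≤ C * ‖J‖ ^ 2 ∧
            ‖(tsV1 (pow_ne_zero j (Nat.cast_ne_zero.2 (NeZero.ne L))) Λ' w).G J‖ ≤ C * ‖J‖ :=
  ⟨_, fun m K j hj Λ' _ hw0 J =>
    ⟨prop25_inner_G_le_V1 (m := m) (K := K) (pow_ne_zero j (Nat.cast_ne_zero.2 (NeZero.ne L))) hj Λ' ha₀ hw0 J,
      prop25_norm_G_le_V1 (m := m) (K := K) (pow_ne_zero j (Nat.cast_ne_zero.2 (NeZero.ne L))) hj Λ' ha₀ hw0 J⟩⟩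


/-! ## §4  (v1.1) The same for the PRINTED weights `a` on `Λ^c`, `a·L^{d−2}` on `Λ′` ((2.90)/(2.94)), floor `a` -/

/-- the printed weights of the two-scale data with constant `a·n^{d+1}` (`…B6SectCTwoScaleV1.wPrinted`: `a·n^{d+1}` on the `Λ^c`-part, `a·n^{d+1}·L^{(d+1)−2}`
on the `Λ′`-part) have the floor `a·n^{d+1}` (`L ≥ 1`). [cite: Balaban1984PropagatorsII, (2.90) p.239, (2.94) p.239] -/
theorem wPrinted_ge_floor {d L m K : ℕ} [NeZero L] {hd : 1 ≤ d + 1} {hL : Odd L ∧ 1 < L} {j : ℕ}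
    (Λ' : Finset (Site (⟨d + 1, L, m, K, hd, hL⟩ : Params) (j + 1))) {a : ℝ} (ha : 0 ≤ a) (i : CIdx j Λ') :
    a * ((L : ℝ) ^ j) ^ (d + 1) ≤ wPrinted (⟨d + 1, L, m, K, hd, hL⟩ : Params) j Λ' (a * ((L : ℝ) ^ j) ^ (d + 1)) i := by
  have hL1 : (1 : ℝ) ≤ L := by exact_mod_cast Nat.one_le_iff_ne_zero.2 (NeZero.ne L)
  cases i with
  | inl x => exact le_rfl
  | inr y =>
      show a * ((L : ℝ) ^ j) ^ (d + 1) ≤ a * ((L : ℝ) ^ j) ^ (d + 1) * (L : ℝ) ^ (d + 1 - 2)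
      exact le_mul_of_one_le_right (by positivity) (one_le_pow₀ hL1)

/-- **PROPOSITION 2.5 (GLOBAL L²-NORM MEMBER, TWO LEVELS) FOR THE PRINTED WEIGHTS**: for every `d + 1`, odd `L > 1` and `a > 0` ONE constant `C` with
`⟨J, GJ⟩ ≤ C‖J‖²`, `‖GJ‖ ≤ C‖J‖` for ALL volumes `(m, K)`, scales `j` (`j + 1 ≤ m + K`), regions `Λ′` and all `J`, `G = Δ_a⁻¹` of the two-scale V1 data at
`c = L^j` with the printed weights `wPrinted (a·n^{d+1})` (= [4]'s `a` in r03's dictionary, as in r03's one-level `…B6Prop25OneLevelV1.oneLevelData`).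
[cite: Balaban1984PropagatorsII, Prop. 2.5 p.246] -/
theorem prop25_l2_bounded_printed (d L : ℕ) [NeZero L] (hd : 1 ≤ d + 1) (hL : Odd L ∧ 1 < L) {a : ℝ} (ha : 0 < a) :
    ∃ C : ℝ, ∀ (m K j : ℕ) (hj : j + 1 ≤ m + K) (Λ' : Finset (Site (⟨d + 1, L, m, K, hd, hL⟩ : Params) (j + 1)))
      (J : BondSpace (⟨d + 1, L, m, K, hd, hL⟩ : Params)),
        ⟪J, (tsV1 (pow_ne_zero j (Nat.cast_ne_zero.2 (NeZero.ne L))) Λ'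
            (wPrinted (⟨d + 1, L, m, K, hd, hL⟩ : Params) j Λ' (a * ((L : ℝ) ^ j) ^ (d + 1)))).G J⟫_ℝ ≤ C * ‖J‖ ^ 2 ∧
          ‖(tsV1 (pow_ne_zero j (Nat.cast_ne_zero.2 (NeZero.ne L))) Λ'
            (wPrinted (⟨d + 1, L, m, K, hd, hL⟩ : Params) j Λ' (a * ((L : ℝ) ^ j) ^ (d + 1)))).G J‖ ≤ C * ‖J‖ := by
  obtain ⟨C, hC⟩ := prop25_l2_bounded_uniform d L hd hL ha
  exact ⟨C, fun m K j hj Λ' J => hC m K j hj Λ' _ (wPrinted_ge_floor Λ' ha.le) J⟩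


/-! ## §5  (v1.1) The curl entry: `‖∂GJ‖² ≤ C‖J‖²` (from `Δ_aG = I` and the three squares of `⟨A, Δ_aA⟩`) -/

section Curl

variable {A B W T Bs V : Type*}
  [NormedAddCommGroup A] [InnerProductSpace ℝ A] [FiniteDimensional ℝ A]
  [NormedAddCommGroup B] [InnerProductSpace ℝ B] [FiniteDimensional ℝ B]
  [NormedAddCommGroup W] [InnerProductSpace ℝ W] [FiniteDimensional ℝ W]
  [NormedAddCommGroup T] [InnerProductSpace ℝ T] [FiniteDimensional ℝ T]
  [NormedAddCommGroup Bs] [InnerProductSpace ℝ Bs] [FiniteDimensional ℝ Bs]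
  [NormedAddCommGroup V] [InnerProductSpace ℝ V] [FiniteDimensional ℝ V]
  {D : TwoScaleData A B W T Bs V}

/-- **`‖∂GJ‖² + ‖R∂*GJ‖² ≤ ⟨J, GJ⟩`-bound**: since `Δ_aG = I`, `⟨GJ, Δ_aGJ⟩ = ⟨J, GJ⟩`, and `⟨A, Δ_aA⟩ = ‖∂A‖² + ‖R∂*A‖² + ⟨QA, aQA⟩` with `a ≥ 0`; so a
form bound `⟨J, GJ⟩ ≤ β‖J‖²` bounds the curl (and the `R∂*`) of `GJ` in `ℓ²` (the curl part of the `∇GJ` entry of (1.114)/(1.115) of [4]).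
[cite: Balaban1984PropagatorsII, Prop. 2.5 p.246 + (2.19) p.226 (step ours)] -/
theorem norm_curl_G_sq_le (hL : D.IsLattice) (hP : D.Positive) {β : ℝ} (hG : ∀ J, ⟪J, D.G J⟫_ℝ ≤ β * ‖J‖ ^ 2) (J : A) :
    ‖D.curl (D.G J)‖ ^ 2 + ‖D.R (D.dv (D.G J))‖ ^ 2 ≤ β * ‖J‖ ^ 2 := by
  have e : D.deltaA (D.G J) = J := by
    have h := LinearMap.congr_fun (deltaA_comp_G hL hP) J
    rw [LinearMap.comp_apply] at h
    exact h
  have h1 : ⟪D.G J, D.deltaA (D.G J)⟫_ℝ = ⟪J, D.G J⟫_ℝ := by rw [e]; exact real_inner_comm _ _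
  have h2 := form_deltaA hL (D.G J)
  have h3 : 0 ≤ ⟪D.Qpp (D.Qv (D.G J)), D.a (D.Qpp (D.Qv (D.G J)))⟫_ℝ := by
    rcases eq_or_ne (D.Qpp (D.Qv (D.G J))) 0 with h0 | hne
    · rw [h0, inner_zero_left]
    · exact (hL.a_pos _ hne).le
  linarith [hG J]

end Curl

section CurlConcrete

variable {d L m K : ℕ} [NeZero L] {hd : 1 ≤ d + 1} {hL : Odd L ∧ 1 < L} {j : ℕ} (hc : ((L : ℝ) ^ j) ≠ 0)
  (hj : j + 1 ≤ (⟨d + 1, L, m, K, hd, hL⟩ : Params).m + (⟨d + 1, L, m, K, hd, hL⟩ : Params).K)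
  (Λ' : Finset (Site (⟨d + 1, L, m, K, hd, hL⟩ : Params) (j + 1))) {w : CIdx j Λ' → ℝ} {a₀ : ℝ} (ha₀ : 0 < a₀)
  (hw0 : ∀ i, a₀ * ((L : ℝ) ^ j) ^ (d + 1) ≤ w i)

include hj ha₀ hw0 in
/-- **the curl entry for the concrete data**: `‖∂(GJ)‖² ≤ C(d, L, a₀)·‖J‖²` at `c = L^j`, weights `a ≥ a₀n^{d+1}` (`∂ = curl = dcE (L^j)`, the plaquette
differential with the factor `η⁻¹`), uniformly in `(m, K)`, `j`, `Λ′` — the curl part of the `ℓ²` entry `∇GJ` of (1.114)/(1.115) of [4].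
[cite: Balaban1984PropagatorsII, Prop. 2.5 p.246] -/
theorem prop25_curl_G_le_V1 (J : BondSpace (⟨d + 1, L, m, K, hd, hL⟩ : Params)) :
    ‖(tsV1 hc Λ' w).curl ((tsV1 hc Λ' w).G J)‖ ^ 2 ≤
      ((d + 1 : ℝ) * (MGHD (d + 1) 1 * periodConst (kappaN (d + 1)) d * latticeConst (d + 1) (kappaN (d + 1) / (d + 1))) ^ 2 *
          (c0_2109 (d + 1) * (8 / (L : ℝ) ^ 2) ^ 2)⁻¹ +
        ((gammaZero (d + 1) 1)⁻¹ +
            ((d + 1 : ℝ) * (MG163 (d + 1) * periodConst (kappa163 (d + 1)) d * latticeConst (d + 1) (kappa163 (d + 1) / (d + 1)))) ^ 2 *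
              (min a₀ 1 * (481 * (d + 1 : ℝ) ^ 6 * (L : ℝ) ^ (2 * (d + 1) + 4))⁻¹)⁻¹) *
          (1 + (d + 1 : ℝ) ^ 2 *
              (MGHD (d + 1) 1 * periodConst (kappaN (d + 1)) d * latticeConst (d + 1) (kappaN (d + 1) / (d + 1))) *
              (MGHD (d + 1) 3 * periodConst (kappaN (d + 1)) d * latticeConst (d + 1) (kappaN (d + 1) / (d + 1))) *
              (c0_2109 (d + 1) * (8 / (L : ℝ) ^ 2) ^ 2)⁻¹) ^ 2) * ‖J‖ ^ 2 := by
  have hw : ∀ i, 0 < w i := fun i => lt_of_lt_of_le (by positivity) (hw0 i)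
  exact le_trans (le_add_of_nonneg_right (sq_nonneg _))
    (norm_curl_G_sq_le (isLattice Λ' hc hj hw) (positive Λ' hc hj w) (prop25_inner_G_le_V1 hc hj Λ' ha₀ hw0) J)

end CurlConcrete

end Literature.MathematicalPhysics.QuantumFieldTheory.Balaban1983to89.B6Prop25BoundedTwoScaleV1

end
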